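import Summits.ResolutionOfSingularities.ResolutionOfSingularities.Theorems.FrobeniusClosingPatchingRelPerfectOfAtomBlowup
import Summits.ResolutionOfSingularities.ResolutionOfSingularities.Theorems.FrobeniusClosingPatchingRelPerfectAtomicRoofEngine
import Summits.ResolutionOfSingularities.ResolutionOfSingularities.Theorems.FrobeniusClosingPatchingRelPerfectGeomAtomLeThree
import Summits.ResolutionOfSingularities.ResolutionOfSingularities.Theorems.FrobeniusClosingPatchingRelPerfectSliceGeFive
import HarnessLib

/-!
# Crux `PatchingRelPerfect` (stmt-ResolutionOfSingularities-16161), line `closed-point-slice` v5.1: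
# CERTIFICATE — the crux BY NAME from the printed inputs and TWO LOCAL statements

Route `ResolutionOfSingularities/FrobeniusClosing`, crux #6 `PatchingRelPerfect` (one term shared by
eight routes). [OURS · L1 W5.2] The certificate of skeleton v5.1 of the line `closed-point-slice`
(chain w52: the planner's blow-up-form core P0 + the lead's all-dimensional engine and local
residual): the crux follows from

* the PRINTED dimension-`≤ 3` theorems (Cossart–Piltant 2019 Thm. 1.1 / Prop. 4.4 as the tree's
  named facts `CossartPiltant2019General` / `CossartPiltant2019Principalization`; CJS 2020 Thm. 1.2
  in single-blow-up format, or the named fact `CossartJannsenSaito2020Sequence`);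
* `hA4B` — THE DIMENSION-4 CORE in blow-up form (OPEN): over a complete regular local `S` of
  dimension `4`, characteristic `p`, PERFECT residue field, every blowing up `Bl_I Spec S`
  (`I ≠ 0`) regular off the closed fibre is made regular by ONE further blowing up cosupported in
  the closed fibre;
* `hR` — THE LOCAL RESIDUAL (OPEN): over a perfect field of characteristic `p`, at a regular point
  `y` of local dimension `≥ 4` of an integral variety of dimension `≥ 5`, every integral `T`
  proper and birational over `Spec 𝒪_{N,y}` and regular off the closed fibre admits a
  desingularization (Temkin 2008, Def. 2.2.6).

Everything else — the engine in dimension `4` (α β γ, res-L1-w52-stub-1) and in every dimension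
(`stub_atomicRoofEngine`, the lead), the printed local stratum (`stub_geomAtomLeThree`), the
dimension-`≥ 5` slice (`stub_sliceGeFive`) — is a theorem of the tree. So the GLOBALISATION BY
PATCHING is proved in every dimension; the two hypotheses are punctual resolution statements over
regular local rings, i.e. the honest open content of "local uniformization ⇒ resolution" over
perfect fields. CONDITIONAL; the item stays open.

## Sources

* V. Cossart, O. Piltant, *Resolution of singularities of arithmetical threefolds*, J. Algebra
  529 (2019) 268–535, Thm. 1.1, Prop. 4.4, proof of Prop. 4.6. [CossartPiltant2019]
* V. Cossart, U. Jannsen, S. Saito, *Desingularization: invariants and strategy*, LNM 2270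
  (2020), Thm. 1.2. [CossartJannsenSaito2020]
* M. Temkin, *Desingularization of quasi-excellent schemes in characteristic zero*, Adv. Math.
  219 (2008) 488–522, Def. 2.2.6, Prop. 2.3.4. [Temkin2008]
* O. Piltant, *An axiomatic version of Zariski's patching theorem*, RACSAM 107 (2013) 91–121,
  Prop. 5.1, Cor. 5.7, p. 2. [Piltant2013]
-/

set_option linter.dupNamespace false -- single-problem summit: doubled namespace component is forced

noncomputable section

open CategoryTheory CategoryTheory.Limits AlgebraicGeometry Literature.AlgebraicGeometry.Resolution
open TopologicalSpace IsLocalRing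

namespace Summit.ResolutionOfSingularities.ResolutionOfSingularities.Theorems

/-- **The dimension-`≥ 5` integral slice over perfect fields of characteristic `p` from the printed
inputs, the blow-up-form dimension-4 core `hA4B`, the local residual `hR` and relative local
uniformization `hLU`** — `stub_sliceGeFive` fed with the landed pieces: the dimension-`≤ 4` slice
(`hasResolution_dimLeFour_of_printed_of_atomDimFourBlowup`), the printed local stratum
(`stub_geomAtomLeThree`) and the atomic roof engine (`stub_atomicRoofEngine`). CONDITIONAL.
[cite: Piltant2013, Prop. 5.1 and Cor. 5.7; Temkin2008, Prop. 2.3.4; CossartPiltant2019, Thm. 1.1 and Prop. 4.4] -/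
theorem hasResolution_dimGeFive_of_printed_of_atomDimFourBlowup_of_residualStrata
    (hG : CossartPiltant2019General.{0}) (hP : CossartPiltant2019Principalization.{0})
    (hCJS : ∀ (X : Scheme.{0}) [IsNoetherian X] [IsReduced X], Scheme.IsExcellent X →
      topologicalKrullDim X ≤ 2 → Scheme.AdmitsDesingularization X)
    (p : ℕ) (hp : p.Prime)
    (hA4B : ∀ (S : Type) [CommRing S] [IsRegularLocalRing S] [CharP S p]
      [IsAdicComplete (IsLocalRing.maximalIdeal S) S]
      [PerfectField (IsLocalRing.ResidueField S)], ringKrullDim S = (4 : ℕ) →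
      ∀ (I : Ideal S), I ≠ ⊥ → ∀ (T : Scheme.{0}) (f : T ⟶ Spec (.of S)),
        IsBlowup f (affineBlowup.idealSheaf I) →
        (∀ t : T, f.base t ≠ IsLocalRing.closedPoint S → IsRegularLocalRing (T.presheaf.stalk t)) →
        ∃ (J : T.IdealSheafData) (T' : Scheme.{0}) (π : T' ⟶ T), J ≠ ⊥ ∧
          (∀ t : T, t ∈ J.support → f.base t = IsLocalRing.closedPoint S) ∧
          IsBlowup π J ∧ Scheme.IsRegular T')
    (hR : ∀ (k : Type) [Field k] [CharP k p] [PerfectField k] (N : Scheme.{0})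
      (gN : N ⟶ Spec (.of k)) [IsSeparated gN] [LocallyOfFiniteType gN] [QuasiCompact gN]
      [IsIntegral N], ¬ topologicalKrullDim N ≤ 4 → ∀ y : N,
      IsRegularLocalRing (N.presheaf.stalk y) → ¬ ringKrullDim (N.presheaf.stalk y) ≤ (3 : ℕ) →
      ∀ (T : Scheme.{0}) (h : T ⟶ Spec (N.presheaf.stalk y)), IsIntegral T → IsProper h →
        IsBirational h →
        (∀ t : T, h.base t ≠ IsLocalRing.closedPoint (N.presheaf.stalk y) →
          IsRegularLocalRing (T.presheaf.stalk t)) →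
        Scheme.AdmitsDesingularization T)
    (hLU : ∀ (k K : Type) [Field k] [CharP k p] [PerfectField k] [Field K] [Algebra k K],
      (⊤ : IntermediateField k K).FG → ∀ O : ValuationSubring K, (∀ c : k, algebraMap k K c ∈ O) →
        ∀ R : Subalgebra k K, R.FG → R.toSubring ≤ O.toSubring →
          ∃ (A : Subalgebra k K) (h : A.toSubring ≤ O.toSubring), R ≤ A ∧ A.FG ∧
            IsFractionRing A K ∧ IsRegularLocalRing (Localization.AtPrime
              (Ideal.comap (Subring.inclusion h) (IsLocalRing.maximalIdeal O))))
    (k : Type) [Field k] [CharP k p] [PerfectField k] (X : Scheme.{0}) (f : X ⟶ Spec (.of k))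
    [IsSeparated f] [LocallyOfFiniteType f] [QuasiCompact f] [IsIntegral X]
    (hX : ¬ topologicalKrullDim X ≤ 4) : Scheme.HasResolution X :=
  stub_sliceGeFive p hp hLU
    (fun k₁ _ _ _ X₁ f₁ hs hl hq hi hX₁ =>
      @hasResolution_dimLeFour_of_printed_of_atomDimFourBlowup hG hP hCJS p hp hA4B hLU
        k₁ _ _ _ X₁ f₁ hs hl hq hi hX₁)
    (fun k₂ _ N gN _ _ y hd T h hT hh hbir =>
      @stub_geomAtomLeThree hG hP hCJS k₂ _ N gN _ _ y hd T h hT hh hbir)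
    hR (fun k₃ _ M g _ _ _ _ hroof => stub_atomicRoofEngine k₃ M g hroof) k X f hX

/-- **The crux `FrobeniusClosing.PatchingRelPerfect` BY NAME from the printed dimension-`≤ 3`
theorems and TWO LOCAL open statements: the blow-up-form dimension-4 core `hA4B` (perfect closed
points of fourfolds) and the local residual `hR` (regular points of local dimension `≥ 4` of
varieties of dimension `≥ 5`)** — certificate of skeleton v5.1 of the line `closed-point-slice`.
Reduce resolution over one perfect `k` to integral closed subschemes over the same `k`
(`hasResolution_of_forall_closeds`), split on `topologicalKrullDim ≤ 4`, and use the two landed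
slices. Patching itself (dimension `4`: α β γ; every dimension: the atomic roof engine) is no
longer a hypothesis. CONDITIONAL; the item stays open.
[cite: CossartPiltant2019, Thm. 1.1 and Prop. 4.4; CossartJannsenSaito2020, Thm. 1.2;
Temkin2008, Prop. 2.3.4 and Def. 2.2.6; Piltant2013, Prop. 5.1 and p. 2] -/
theorem patchingRelPerfect_of_printed_of_atomDimFourBlowup_of_residualStrata
    (hG : CossartPiltant2019General.{0}) (hP : CossartPiltant2019Principalization.{0})
    (hCJS : ∀ (X : Scheme.{0}) [IsNoetherian X] [IsReduced X], Scheme.IsExcellent X →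
      topologicalKrullDim X ≤ 2 → Scheme.AdmitsDesingularization X)
    (hA4B : ∀ (p : ℕ), p.Prime → ∀ (S : Type) [CommRing S] [IsRegularLocalRing S] [CharP S p]
      [IsAdicComplete (IsLocalRing.maximalIdeal S) S]
      [PerfectField (IsLocalRing.ResidueField S)], ringKrullDim S = (4 : ℕ) →
      ∀ (I : Ideal S), I ≠ ⊥ → ∀ (T : Scheme.{0}) (f : T ⟶ Spec (.of S)),
        IsBlowup f (affineBlowup.idealSheaf I) →
        (∀ t : T, f.base t ≠ IsLocalRing.closedPoint S → IsRegularLocalRing (T.presheaf.stalk t)) →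
        ∃ (J : T.IdealSheafData) (T' : Scheme.{0}) (π : T' ⟶ T), J ≠ ⊥ ∧
          (∀ t : T, t ∈ J.support → f.base t = IsLocalRing.closedPoint S) ∧
          IsBlowup π J ∧ Scheme.IsRegular T')
    (hR : ∀ (p : ℕ), p.Prime → ∀ (k : Type) [Field k] [CharP k p] [PerfectField k]
      (N : Scheme.{0}) (gN : N ⟶ Spec (.of k)) [IsSeparated gN] [LocallyOfFiniteType gN]
      [QuasiCompact gN] [IsIntegral N], ¬ topologicalKrullDim N ≤ 4 → ∀ y : N,
      IsRegularLocalRing (N.presheaf.stalk y) → ¬ ringKrullDim (N.presheaf.stalk y) ≤ (3 : ℕ) →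
      ∀ (T : Scheme.{0}) (h : T ⟶ Spec (N.presheaf.stalk y)), IsIntegral T → IsProper h →
        IsBirational h →
        (∀ t : T, h.base t ≠ IsLocalRing.closedPoint (N.presheaf.stalk y) →
          IsRegularLocalRing (T.presheaf.stalk t)) →
        Scheme.AdmitsDesingularization T) :
    Summit.ResolutionOfSingularities.ResolutionOfSingularities.Theses.FrobeniusClosing.PatchingRelPerfect := by
  intro p hp hLU k _ _ _ X f hsep hft hqc hred
  haveI := hft; haveI := hqc; haveI := hred
  refine hasResolution_of_forall_closeds X f fun Z hZ => ?_
  haveI := hZ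
  let ι := (Scheme.IdealSheafData.vanishingIdeal Z).subschemeι
  by_cases hd : topologicalKrullDim ↥(Scheme.IdealSheafData.vanishingIdeal Z).subscheme ≤ 4
  · exact hasResolution_dimLeFour_of_printed_of_atomDimFourBlowup hG hP hCJS p hp (hA4B p hp)
      hLU k _ (ι ≫ f) hd
  · exact hasResolution_dimGeFive_of_printed_of_atomDimFourBlowup_of_residualStrata hG hP hCJS
      p hp (hA4B p hp) (hR p hp) hLU k _ (ι ≫ f) hd

/-- The same with the CJS conjunct from the NAMED FACT `CossartJannsenSaito2020Sequence`: **the crux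
BY NAME from three named facts of the tree and the two local open statements** (the dimension-4
core at perfect closed points; the local residual in dimension `≥ 5`). CONDITIONAL.
[cite: CossartPiltant2019, Thm. 1.1 and Prop. 4.4] [cite: CossartJannsenSaito2020, Thm. 1.2]
[cite: Temkin2008, Def. 2.2.6] -/
theorem patchingRelPerfect_of_namedFacts_of_atomDimFourBlowup_of_residualStrata
    (hG : CossartPiltant2019General.{0}) (hP : CossartPiltant2019Principalization.{0})
    (hS : CossartJannsenSaito2020Sequence.{0})
    (hA4B : ∀ (p : ℕ), p.Prime → ∀ (S : Type) [CommRing S] [IsRegularLocalRing S] [CharP S p]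
      [IsAdicComplete (IsLocalRing.maximalIdeal S) S]
      [PerfectField (IsLocalRing.ResidueField S)], ringKrullDim S = (4 : ℕ) →
      ∀ (I : Ideal S), I ≠ ⊥ → ∀ (T : Scheme.{0}) (f : T ⟶ Spec (.of S)),
        IsBlowup f (affineBlowup.idealSheaf I) →
        (∀ t : T, f.base t ≠ IsLocalRing.closedPoint S → IsRegularLocalRing (T.presheaf.stalk t)) →
        ∃ (J : T.IdealSheafData) (T' : Scheme.{0}) (π : T' ⟶ T), J ≠ ⊥ ∧
          (∀ t : T, t ∈ J.support → f.base t = IsLocalRing.closedPoint S) ∧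
          IsBlowup π J ∧ Scheme.IsRegular T')
    (hR : ∀ (p : ℕ), p.Prime → ∀ (k : Type) [Field k] [CharP k p] [PerfectField k]
      (N : Scheme.{0}) (gN : N ⟶ Spec (.of k)) [IsSeparated gN] [LocallyOfFiniteType gN]
      [QuasiCompact gN] [IsIntegral N], ¬ topologicalKrullDim N ≤ 4 → ∀ y : N,
      IsRegularLocalRing (N.presheaf.stalk y) → ¬ ringKrullDim (N.presheaf.stalk y) ≤ (3 : ℕ) →
      ∀ (T : Scheme.{0}) (h : T ⟶ Spec (N.presheaf.stalk y)), IsIntegral T → IsProper h →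
        IsBirational h →
        (∀ t : T, h.base t ≠ IsLocalRing.closedPoint (N.presheaf.stalk y) →
          IsRegularLocalRing (T.presheaf.stalk t)) →
        Scheme.AdmitsDesingularization T) :
    Summit.ResolutionOfSingularities.ResolutionOfSingularities.Theses.FrobeniusClosing.PatchingRelPerfect :=
  patchingRelPerfect_of_printed_of_atomDimFourBlowup_of_residualStrata hG hP
    (cjs2020BlowupFormat_of_cossartJannsenSaito2020Sequence hS) hA4B hR

end Summit.ResolutionOfSingularities.ResolutionOfSingularities.Theorems

end
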